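import Mathlib
import HarnessLib
import Summits.Ventures.LatticeQCDFlow.Exactness.NCMCGeneralSpace

/-!
# The NCMC switch as a Mathlib `Kernel` on `Bool × Ω`: reversible and invariant for every Crooks pair

HONEST FRAMING: exact (Metropolis-corrected) sampling algorithms for lattice gauge theory;
figures of merit are autocorrelation/cost numbers at stated couplings and volumes; no
continuum-physics claim.

Venture `LatticeQCDFlow` (cell pub-lqcd), topic `Exactness`; FANOUT row 13 (`eng-snf`, GEN-9).
NEW WORK of the cell (general measure theory, elementary), not a published result; nothing is
cited as a fact (Nilmeier–Crooks–Minh–Chodera 2011 and Crooks 1998/2000 named only).  Companion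
of `Exactness/NCMCGeneralSpace.lean`, which supplies the `CrooksPair` hypothesis, the accepted
flows `fwdFlow` / `revFlow` and the detailed balance between the levels
(`CrooksPair.levelBalance`); the finite-space version is `Exactness/NCMCExpandedEnsemble.lean`
(`ncmcKernel_detailedBalance`, `ncmcKernel_isStationary`).

## Content (general measurable `Ω`, record space `E`, Markov record kernels `κF κR : Kernel Ω E`)

* `jointWeight c ν₀ ν₁ = ν₀ ⊗ δ_false + e^{c} ν₁ ⊗ δ_true` — the un-normalised joint weight `Π_c`
  of the expanded ensemble on `Bool × Ω` (`Measure.map (Prod.mk b)`); `jointWeight_apply`,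
  `jointWeight_targetLevel` (`= e^{c} Z₁`), `jointWeight_compl_targetLevel` (`= Z₀`) — the level
  masses behind the occupancy law `P(target) = 1/(1 + e^{-(c − ΔF)})`;
* `switchKernel κF κR c W s e : Kernel (Bool × Ω) (Bool × Ω)` — THE SAMPLER'S SWITCH MOVE as a
  Mathlib kernel: from a prior state `(false, x)` draw a forward record from `κF x`, accept its
  end point on the target level with probability `accF = min 1 e^{-(W − c)}`, else stay
  (`fwdProposal + fwdStay`); from a target state `(true, y)` the reverse record from `κR y`, its
  start point on the prior level, `accR = min 1 e^{W − c}` (`revProposal + revStay`); glued by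
  `Kernel.piecewise` on the target level;
* `switchKernel_apply_prior`, `switchKernel_apply_target` — the set-wise formulas
  `K((false, x), S) = F_c(x, S_true) + (1 − F_c(x, Ω)) 1_S(false, x)` etc.;
  `isMarkovKernel_switchKernel` — total mass one;
* `setLIntegral_jointWeight`, `setLIntegral_switchKernel` — the mass flow `∫_{A'} K(p, B') dΠ_c`
  as accepted forward flow + rejected prior mass + accepted reverse flow + rejected target mass;
* **`switchKernel_isReversible`** — `Kernel.IsReversible (switchKernel …) (jointWeight c ν₀ ν₁)`
  for EVERY Crooks pair and EVERY constant `c` (the accepted flows are exchanged by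
  `levelBalance`, the rejected masses sit on the diagonal);
* **`switchKernel_invariant`** — `Kernel.Invariant`: the joint weight is invariant, so the chain
  watched on the target level samples `ν₁` (normalised) whatever the protocol — its quality enters
  only the acceptances, `c` only the occupancy of the levels;
* `levelKernel T₀ T₁`, `levelKernel_invariant`, **`iteration_invariant`** — relaxing at the current
  level with kernels invariant for that level's weight, then switching, leaves `Π_c` invariant
  (Mathlib `Kernel.Invariant.comp`): one full iteration of the engine's `run_ncmc_chain` is exact.
-/

namespace Summit.Ventures.LatticeQCDFlow.Exactness.GeneralNCMC

open MeasureTheory ProbabilityTheory Set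
open scoped ENNReal

variable {Ω E : Type*} [MeasurableSpace Ω] [MeasurableSpace E]

/-! ## The expanded-ensemble switch kernel on `Bool × Ω` (Mathlib `Kernel`) -/

section SwitchKernel

/-- Tag the END point of a record with the target level. -/
def toTarget (e : E → Ω) (ε : E) : Bool × Ω := (true, e ε)

/-- Tag the START point of a record with the prior level. -/
def toPrior (s : E → Ω) (ε : E) : Bool × Ω := (false, s ε)

omit [MeasurableSpace Ω] [MeasurableSpace E] in
/-- Unfolding lemma. -/
@[simp] theorem toTarget_apply (e : E → Ω) (ε : E) : toTarget e ε = (true, e ε) := rfl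

omit [MeasurableSpace Ω] [MeasurableSpace E] in
/-- Unfolding lemma. -/
@[simp] theorem toPrior_apply (s : E → Ω) (ε : E) : toPrior s ε = (false, s ε) := rfl

/-- Measurability of the target tagging map. -/
theorem measurable_toTarget {e : E → Ω} (he : Measurable e) : Measurable (toTarget e) :=
  measurable_const.prodMk he

/-- Measurability of the prior tagging map. -/
theorem measurable_toPrior {s : E → Ω} (hs : Measurable s) : Measurable (toPrior s) :=
  measurable_const.prodMk hs

variable (Ω) in
/-- The target level `{true} × Ω` of the expanded ensemble. -/
def targetLevel : Set (Bool × Ω) := Prod.fst ⁻¹' {true}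

/-- The target level is a measurable set. -/
theorem measurableSet_targetLevel : MeasurableSet (targetLevel Ω) :=
  measurable_fst (measurableSet_singleton true)

omit [MeasurableSpace Ω] in
/-- Membership in the target level is read off the Boolean tag. -/
@[simp] theorem mem_targetLevel (p : Bool × Ω) : p ∈ targetLevel Ω ↔ p.1 = true := by
  simp [targetLevel]

/-- Membership in the target level is decidable (read off the Boolean tag). -/
instance decidableMemTargetLevel : DecidablePred (· ∈ targetLevel Ω) :=
  fun p => inferInstanceAs (Decidable (p.1 = true))

/-- The un-normalised JOINT WEIGHT of the expanded ensemble: `ν₀` on the prior level, `e^{c} ν₁` on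
the target level (`Π_c`; on a finite space `NCMCExpandedEnsemble.ncmcWeight`). -/
noncomputable def jointWeight (c : ℝ) (ν₀ ν₁ : Measure Ω) : Measure (Bool × Ω) :=
  ν₀.map (Prod.mk false) + ENNReal.ofReal (Real.exp c) • ν₁.map (Prod.mk true)

/-- Set-wise formula for the joint weight: `Π_c(S) = ν₀(S_false) + e^{c} ν₁(S_true)`. -/
theorem jointWeight_apply (c : ℝ) (ν₀ ν₁ : Measure Ω) {S : Set (Bool × Ω)} (hS : MeasurableSet S) :
    jointWeight c ν₀ ν₁ S =
      ν₀ (Prod.mk false ⁻¹' S) + ENNReal.ofReal (Real.exp c) * ν₁ (Prod.mk true ⁻¹' S) := by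
  rw [jointWeight, Measure.add_apply, Measure.smul_apply, Measure.map_apply measurable_prodMk_left hS,
    Measure.map_apply measurable_prodMk_left hS, smul_eq_mul]

/-- Mass of the target level: `Π_c({target} × Ω) = e^{c} · ν₁(Ω)` (`= e^{c} Z₁`). -/
theorem jointWeight_targetLevel (c : ℝ) (ν₀ ν₁ : Measure Ω) :
    jointWeight c ν₀ ν₁ (targetLevel Ω) = ENNReal.ofReal (Real.exp c) * ν₁ univ := by
  rw [jointWeight_apply c ν₀ ν₁ measurableSet_targetLevel]
  have h0 : Prod.mk false ⁻¹' targetLevel Ω = (∅ : Set Ω) := by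
    ext x; simp [targetLevel]
  have h1 : Prod.mk true ⁻¹' targetLevel Ω = (univ : Set Ω) := by
    ext x; simp [targetLevel]
  rw [h0, h1, measure_empty, zero_add]

/-- Mass of the prior level: `Π_c({prior} × Ω) = ν₀(Ω)` (`= Z₀`).  Hence the stationary OCCUPANCY
of the target level is `e^{c} Z₁ / (Z₀ + e^{c} Z₁) = 1 / (1 + e^{-(c − ΔF)})`, `ΔF = log Z₀ − log Z₁`
— what the engine's `dF_occ = c − logit(occupancy)` reads (finite version:
`NCMCExpandedEnsemble.ncmc_occupancy`); and conditioned on the target level the joint weight is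
`ν₁` normalised. -/
theorem jointWeight_compl_targetLevel (c : ℝ) (ν₀ ν₁ : Measure Ω) :
    jointWeight c ν₀ ν₁ (targetLevel Ω)ᶜ = ν₀ univ := by
  rw [jointWeight_apply c ν₀ ν₁ measurableSet_targetLevel.compl]
  have h0 : Prod.mk false ⁻¹' (targetLevel Ω)ᶜ = (univ : Set Ω) := by
    ext x; simp [targetLevel]
  have h1 : Prod.mk true ⁻¹' (targetLevel Ω)ᶜ = (∅ : Set Ω) := by
    ext x; simp [targetLevel]
  rw [h0, h1, measure_empty, mul_zero, add_zero]

/-- Accepted forward proposals, read on the expanded ensemble: from `(b, x)` draw a forward record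
from `κF x`, keep it with probability `accF`, and move to its end point on the target level. -/
noncomputable def fwdProposal (κF : Kernel Ω E) [IsMarkovKernel κF] (c : ℝ) (W : E → ℝ)
    (e : E → Ω) : Kernel (Bool × Ω) (Bool × Ω) :=
  Kernel.prodMkLeft Bool (Kernel.map (Kernel.withDensity κF fun _ => accF c W) (toTarget e))

/-- Accepted reverse proposals: from `(b, y)` draw a reverse record from `κR y`, keep it with
probability `accR`, and move to its start point on the prior level. -/
noncomputable def revProposal (κR : Kernel Ω E) [IsMarkovKernel κR] (c : ℝ) (W : E → ℝ)
    (s : E → Ω) : Kernel (Bool × Ω) (Bool × Ω) :=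
  Kernel.prodMkLeft Bool (Kernel.map (Kernel.withDensity κR fun _ => accR c W) (toPrior s))

/-- Rejected forward mass stays put. -/
noncomputable def fwdStay (κF : Kernel Ω E) (c : ℝ) (W : E → ℝ) (e : E → Ω) :
    Kernel (Bool × Ω) (Bool × Ω) :=
  Kernel.withDensity Kernel.id fun p _ => 1 - fwdFlow κF c W e p.2 univ

/-- Rejected reverse mass stays put. -/
noncomputable def revStay (κR : Kernel Ω E) (c : ℝ) (W : E → ℝ) (s : E → Ω) :
    Kernel (Bool × Ω) (Bool × Ω) :=
  Kernel.withDensity Kernel.id fun p _ => 1 - revFlow κR c W s p.2 univ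

/-- **The NCMC switch kernel on a general state space**: from the prior level a Metropolized
forward switch to the target level, from the target level a Metropolized reverse switch to the
prior level; rejected proposals stay. -/
noncomputable def switchKernel (κF κR : Kernel Ω E) [IsMarkovKernel κF] [IsMarkovKernel κR]
    (c : ℝ) (W : E → ℝ) (s e : E → Ω) : Kernel (Bool × Ω) (Bool × Ω) :=
  Kernel.piecewise measurableSet_targetLevel
    (revProposal κR c W s + revStay κR c W s) (fwdProposal κF c W e + fwdStay κF c W e)

variable {κF κR : Kernel Ω E} [IsMarkovKernel κF] [IsMarkovKernel κR] {c : ℝ} {W : E → ℝ}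
  {s e : E → Ω}

/-- Set-wise formula from a prior state:
`K((false, x), S) = ∫ accF · 1_S(true, end) dκF x + (1 − F_c(x, Ω)) 1_S(false, x)`. -/
theorem switchKernel_apply_prior (hW : Measurable W) (he : Measurable e) (x : Ω) {S : Set (Bool × Ω)}
    (hS : MeasurableSet S) :
    switchKernel κF κR c W s e (false, x) S =
      fwdFlow κF c W e x (Prod.mk true ⁻¹' S) +
        (1 - fwdFlow κF c W e x univ) * S.indicator 1 (false, x) := by
  have hnot : (false, x) ∉ targetLevel Ω := by simp
  have hacc : Measurable (Function.uncurry fun (_ : Ω) (ε : E) => accF c W ε) :=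
    (measurable_accF c hW).comp measurable_snd
  have hstay : Measurable (Function.uncurry fun (p : Bool × Ω) (_ : Bool × Ω) =>
      1 - fwdFlow κF c W e p.2 univ) :=
    measurable_const.sub
      (((measurable_fwdFlow κF c hW he MeasurableSet.univ).comp measurable_snd).comp measurable_fst)
  rw [switchKernel, Kernel.piecewise_apply, if_neg hnot, Kernel.add_apply, Measure.add_apply,
    fwdProposal, Kernel.prodMkLeft_apply, Kernel.map_apply' _ (measurable_toTarget he) _ hS,
    Kernel.withDensity_apply' _ hacc, fwdStay, Kernel.withDensity_apply' _ hstay, Kernel.id_apply,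
    setLIntegral_const, Measure.dirac_apply' _ hS]
  congr 1
  rw [fwdFlow, CrooksPair.setLIntegral_eq_indicator_mul _ ((measurable_toTarget he) hS)]
  refine lintegral_congr fun ε => ?_
  rw [mul_comm]
  rfl

/-- Set-wise formula from a target state:
`K((true, y), S) = ∫ accR · 1_S(false, start) dκR y + (1 − R_c(y, Ω)) 1_S(true, y)`. -/
theorem switchKernel_apply_target (hW : Measurable W) (hs : Measurable s) (y : Ω)
    {S : Set (Bool × Ω)} (hS : MeasurableSet S) :
    switchKernel κF κR c W s e (true, y) S =
      revFlow κR c W s y (Prod.mk false ⁻¹' S) +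
        (1 - revFlow κR c W s y univ) * S.indicator 1 (true, y) := by
  have hmem : (true, y) ∈ targetLevel Ω := by simp
  have hacc : Measurable (Function.uncurry fun (_ : Ω) (ε : E) => accR c W ε) :=
    (measurable_accR c hW).comp measurable_snd
  have hstay : Measurable (Function.uncurry fun (p : Bool × Ω) (_ : Bool × Ω) =>
      1 - revFlow κR c W s p.2 univ) :=
    measurable_const.sub
      (((measurable_revFlow κR c hW hs MeasurableSet.univ).comp measurable_snd).comp measurable_fst)
  rw [switchKernel, Kernel.piecewise_apply, if_pos hmem, Kernel.add_apply, Measure.add_apply,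
    revProposal, Kernel.prodMkLeft_apply, Kernel.map_apply' _ (measurable_toPrior hs) _ hS,
    Kernel.withDensity_apply' _ hacc, revStay, Kernel.withDensity_apply' _ hstay, Kernel.id_apply,
    setLIntegral_const, Measure.dirac_apply' _ hS]
  congr 1
  rw [revFlow, CrooksPair.setLIntegral_eq_indicator_mul _ ((measurable_toPrior hs) hS)]
  refine lintegral_congr fun ε => ?_
  rw [mul_comm]
  rfl

/-- The switch kernel is Markov (total mass one from every state). -/
theorem isMarkovKernel_switchKernel (hW : Measurable W) (hs : Measurable s) (he : Measurable e) :
    IsMarkovKernel (switchKernel κF κR c W s e) := by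
  refine ⟨fun p => ⟨?_⟩⟩
  obtain ⟨b, x⟩ := p
  cases b
  · rw [switchKernel_apply_prior hW he x MeasurableSet.univ, Set.preimage_univ, indicator_univ,
      Pi.one_apply, mul_one]
    exact add_tsub_cancel_of_le (fwdFlow_le_one κF c W e x univ)
  · rw [switchKernel_apply_target hW hs x MeasurableSet.univ, Set.preimage_univ, indicator_univ,
      Pi.one_apply, mul_one]
    exact add_tsub_cancel_of_le (revFlow_le_one κR c W s x univ)

/-- Integrals against the joint weight split by level. -/
theorem setLIntegral_jointWeight (c : ℝ) (ν₀ ν₁ : Measure Ω) {A' : Set (Bool × Ω)}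
    (hA' : MeasurableSet A') {f : Bool × Ω → ℝ≥0∞} (hf : Measurable f) :
    ∫⁻ p in A', f p ∂(jointWeight c ν₀ ν₁) =
      ∫⁻ x in Prod.mk false ⁻¹' A', f (false, x) ∂ν₀ +
        ENNReal.ofReal (Real.exp c) * ∫⁻ y in Prod.mk true ⁻¹' A', f (true, y) ∂ν₁ := by
  rw [jointWeight, Measure.restrict_add, lintegral_add_measure, Measure.restrict_smul,
    lintegral_smul_measure, setLIntegral_map hA' hf measurable_prodMk_left,
    setLIntegral_map hA' hf measurable_prodMk_left, smul_eq_mul]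

/-- The mass flow `∫_{A'} K(p, B') dΠ_c` of the switch kernel, as four terms: accepted forward flow,
rejected prior mass, accepted reverse flow, rejected target mass. -/
theorem setLIntegral_switchKernel (hW : Measurable W) (hs : Measurable s) (he : Measurable e)
    (ν₀ ν₁ : Measure Ω) {A' B' : Set (Bool × Ω)} (hA' : MeasurableSet A') (hB' : MeasurableSet B') :
    ∫⁻ p in A', switchKernel κF κR c W s e p B' ∂(jointWeight c ν₀ ν₁) =
      ∫⁻ x in Prod.mk false ⁻¹' A', fwdFlow κF c W e x (Prod.mk true ⁻¹' B') ∂ν₀ +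
        ∫⁻ x in Prod.mk false ⁻¹' B' ∩ Prod.mk false ⁻¹' A', (1 - fwdFlow κF c W e x univ) ∂ν₀ +
      ENNReal.ofReal (Real.exp c) *
        (∫⁻ y in Prod.mk true ⁻¹' A', revFlow κR c W s y (Prod.mk false ⁻¹' B') ∂ν₁ +
          ∫⁻ y in Prod.mk true ⁻¹' B' ∩ Prod.mk true ⁻¹' A', (1 - revFlow κR c W s y univ) ∂ν₁) := by
  haveI := isMarkovKernel_switchKernel (κF := κF) (κR := κR) (c := c) hW hs he
  have hA₀ : MeasurableSet (Prod.mk false ⁻¹' A') := measurable_prodMk_left hA'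
  have hA₁ : MeasurableSet (Prod.mk true ⁻¹' A') := measurable_prodMk_left hA'
  have hB₀ : MeasurableSet (Prod.mk false ⁻¹' B') := measurable_prodMk_left hB'
  have hB₁ : MeasurableSet (Prod.mk true ⁻¹' B') := measurable_prodMk_left hB'
  have hFB : Measurable fun x => fwdFlow κF c W e x (Prod.mk true ⁻¹' B') :=
    measurable_fwdFlow κF c hW he hB₁
  have hFu : Measurable fun x => 1 - fwdFlow κF c W e x univ :=
    measurable_const.sub (measurable_fwdFlow κF c hW he MeasurableSet.univ)
  have hRB : Measurable fun y => revFlow κR c W s y (Prod.mk false ⁻¹' B') :=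
    measurable_revFlow κR c hW hs hB₀
  have hRu : Measurable fun y => 1 - revFlow κR c W s y univ :=
    measurable_const.sub (measurable_revFlow κR c hW hs MeasurableSet.univ)
  rw [setLIntegral_jointWeight c ν₀ ν₁ hA' (Kernel.measurable_coe _ hB')]
  congr 1
  · simp_rw [switchKernel_apply_prior hW he _ hB']
    rw [lintegral_add_left hFB]
    congr 1
    have hind : ∀ x, (1 - fwdFlow κF c W e x univ) * B'.indicator 1 (false, x) =
        (Prod.mk false ⁻¹' B').indicator (fun x => 1 - fwdFlow κF c W e x univ) x := fun x => by
      by_cases hx : (false, x) ∈ B'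
      · rw [indicator_of_mem hx, indicator_of_mem (show x ∈ Prod.mk false ⁻¹' B' from hx),
          Pi.one_apply, mul_one]
      · rw [indicator_of_notMem hx, indicator_of_notMem (show x ∉ Prod.mk false ⁻¹' B' from hx),
          mul_zero]
    simp_rw [hind]
    rw [lintegral_indicator hB₀, Measure.restrict_restrict hB₀]
  · congr 1
    simp_rw [switchKernel_apply_target hW hs _ hB']
    rw [lintegral_add_left hRB]
    congr 1
    have hind : ∀ y, (1 - revFlow κR c W s y univ) * B'.indicator 1 (true, y) =
        (Prod.mk true ⁻¹' B').indicator (fun y => 1 - revFlow κR c W s y univ) y := fun y => by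
      by_cases hy : (true, y) ∈ B'
      · rw [indicator_of_mem hy, indicator_of_mem (show y ∈ Prod.mk true ⁻¹' B' from hy),
          Pi.one_apply, mul_one]
      · rw [indicator_of_notMem hy, indicator_of_notMem (show y ∉ Prod.mk true ⁻¹' B' from hy),
          mul_zero]
    simp_rw [hind]
    rw [lintegral_indicator hB₁, Measure.restrict_restrict hB₁]

/-- **E-class statement on a general state space: the NCMC switch kernel is REVERSIBLE for the
joint weight `Π_c`, for every Crooks pair and every constant `c`** (Mathlib's
`Kernel.IsReversible`).  The two accepted flows are exchanged by `CrooksPair.levelBalance`; the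
rejected masses sit on the diagonal. -/
theorem switchKernel_isReversible {ν₀ ν₁ : Measure Ω} (h : CrooksPair ν₀ ν₁ κF κR s e W) (c : ℝ) :
    Kernel.IsReversible (switchKernel κF κR c W s e) (jointWeight c ν₀ ν₁) := by
  intro A' B' hA' hB'
  rw [setLIntegral_switchKernel h.measurable_W h.measurable_s h.measurable_e ν₀ ν₁ hA' hB',
    setLIntegral_switchKernel h.measurable_W h.measurable_s h.measurable_e ν₀ ν₁ hB' hA',
    h.levelBalance c (measurable_prodMk_left hA') (measurable_prodMk_left hB'),
    h.levelBalance c (measurable_prodMk_left hB') (measurable_prodMk_left hA'),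
    Set.inter_comm (Prod.mk false ⁻¹' A'), Set.inter_comm (Prod.mk true ⁻¹' A'), mul_add, mul_add]
  ring

/-- **Exactness: the joint weight `Π_c` is INVARIANT under the NCMC switch kernel** — for every
`c`, every pair of level weights and every protocol certified as a Crooks pair; conditioned on
the target level the chain samples `ν₁` (normalised), whatever the protocol's quality, which only
enters the acceptances. -/
theorem switchKernel_invariant {ν₀ ν₁ : Measure Ω} (h : CrooksPair ν₀ ν₁ κF κR s e W) (c : ℝ) :
    Kernel.Invariant (switchKernel κF κR c W s e) (jointWeight c ν₀ ν₁) := by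
  haveI := isMarkovKernel_switchKernel (κF := κF) (κR := κR) (c := c)
    h.measurable_W h.measurable_s h.measurable_e
  exact (switchKernel_isReversible h c).invariant


/-! ## Level-wise relaxation and one full iteration of the sampler -/

/-- Level-wise relaxation on the expanded ensemble: move with `T₀` on the prior level and with `T₁`
on the target level, never changing the level (the engine's sweeps between switches). -/
noncomputable def levelKernel (T₀ T₁ : Kernel Ω Ω) : Kernel (Bool × Ω) (Bool × Ω) :=
  Kernel.piecewise measurableSet_targetLevel
    (Kernel.prodMkLeft Bool (Kernel.map T₁ (Prod.mk true)))
    (Kernel.prodMkLeft Bool (Kernel.map T₀ (Prod.mk false)))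

/-- From a prior state the level kernel moves with `T₀` inside the prior level. -/
theorem levelKernel_apply_prior (T₀ T₁ : Kernel Ω Ω) (x : Ω) {S : Set (Bool × Ω)}
    (hS : MeasurableSet S) : levelKernel T₀ T₁ (false, x) S = T₀ x (Prod.mk false ⁻¹' S) := by
  have hnot : (false, x) ∉ targetLevel Ω := by simp
  rw [levelKernel, Kernel.piecewise_apply, if_neg hnot, Kernel.prodMkLeft_apply,
    Kernel.map_apply' _ measurable_prodMk_left _ hS]

/-- From a target state the level kernel moves with `T₁` inside the target level. -/
theorem levelKernel_apply_target (T₀ T₁ : Kernel Ω Ω) (y : Ω) {S : Set (Bool × Ω)}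
    (hS : MeasurableSet S) : levelKernel T₀ T₁ (true, y) S = T₁ y (Prod.mk true ⁻¹' S) := by
  have hmem : (true, y) ∈ targetLevel Ω := by simp
  rw [levelKernel, Kernel.piecewise_apply, if_pos hmem, Kernel.prodMkLeft_apply,
    Kernel.map_apply' _ measurable_prodMk_left _ hS]

/-- Integrals against the joint weight, split by level. -/
theorem lintegral_jointWeight (c : ℝ) (ν₀ ν₁ : Measure Ω) {f : Bool × Ω → ℝ≥0∞}
    (hf : Measurable f) :
    ∫⁻ p, f p ∂(jointWeight c ν₀ ν₁) =
      ∫⁻ x, f (false, x) ∂ν₀ + ENNReal.ofReal (Real.exp c) * ∫⁻ y, f (true, y) ∂ν₁ := by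
  rw [jointWeight, lintegral_add_measure, lintegral_smul_measure,
    lintegral_map hf measurable_prodMk_left, lintegral_map hf measurable_prodMk_left, smul_eq_mul]

/-- **Relaxing at the current level is exact**: if `T₀` leaves `ν₀` and `T₁` leaves `ν₁` invariant
(heat-bath / over-relaxation sweeps for the prior and the target action), the level kernel leaves
`Π_c` invariant for every `c` (finite version: `NCMCExpandedEnsemble.levelKernel_isStationary`). -/
theorem levelKernel_invariant {ν₀ ν₁ : Measure Ω} {T₀ T₁ : Kernel Ω Ω}
    (hT₀ : Kernel.Invariant T₀ ν₀) (hT₁ : Kernel.Invariant T₁ ν₁) (c : ℝ) :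
    Kernel.Invariant (levelKernel T₀ T₁) (jointWeight c ν₀ ν₁) := by
  change (jointWeight c ν₀ ν₁).bind ⇑(levelKernel T₀ T₁) = jointWeight c ν₀ ν₁
  ext S hS
  rw [Measure.bind_apply hS (Kernel.aemeasurable _),
    lintegral_jointWeight c ν₀ ν₁ (Kernel.measurable_coe _ hS)]
  simp_rw [levelKernel_apply_prior _ _ _ hS, levelKernel_apply_target _ _ _ hS]
  rw [← Measure.bind_apply (measurable_prodMk_left hS) (Kernel.aemeasurable _),
    ← Measure.bind_apply (measurable_prodMk_left hS) (Kernel.aemeasurable _), hT₀.def, hT₁.def,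
    jointWeight_apply c ν₀ ν₁ hS]

/-- **One full iteration of the `ncmc-metropolis` sampler is exact on a general state space**:
relax at the current level (`levelKernel T₀ T₁`, kernels invariant for their level's weight), then
perform the Metropolized switch of a Crooks pair — the composite kernel leaves `Π_c` invariant, for
every `c` (finite version: `NCMCExpandedEnsemble.ncmcIteration_isStationary`). -/
theorem iteration_invariant {ν₀ ν₁ : Measure Ω} (h : CrooksPair ν₀ ν₁ κF κR s e W)
    {T₀ T₁ : Kernel Ω Ω} (hT₀ : Kernel.Invariant T₀ ν₀) (hT₁ : Kernel.Invariant T₁ ν₁) (c : ℝ) :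
    Kernel.Invariant (switchKernel κF κR c W s e ∘ₖ levelKernel T₀ T₁) (jointWeight c ν₀ ν₁) :=
  (switchKernel_invariant h c).comp (levelKernel_invariant hT₀ hT₁ c)

end SwitchKernel

end Summit.Ventures.LatticeQCDFlow.Exactness.GeneralNCMC
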